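import Summits.ResolutionOfSingularities.ResolutionOfSingularities.Theorems.FrobeniusLadderFRationalResolutionResolutionOpenGlue
import Literature.AlgebraicGeometry.Resolution.AffineBlowupCartier
import Literature.AlgebraicGeometry.Resolution.AffineBlowupRegular
import Literature.AlgebraicGeometry.Resolution.ResolutionGlue
import Literature.AlgebraicGeometry.Resolution.BlowupsComposition
import Summits.ResolutionOfSingularities.ResolutionOfSingularities.Theorems.FrobeniusLadderFRationalResolutionAnResolutionBase
import HarnessLib

/-!
# One step of a tower of point blow-ups: abstract gluing pattern and chart bookkeeping

Support file for crux stmt-ResolutionOfSingularities-15317 (`FrobeniusLadder.FRationalResolution`),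
line `Sketch`, continuation seat c3 (the `A_n` programme for rung 4′). Everything here is stated for
ABSTRACT rings and schemes (cheap to elaborate and kernel-check; reusable for every tower of point
blow-ups of surfaces — `D_n`, `E_n`, toric):

* `towerStep` — if `π₀ : B → X` is proper and an isomorphism over `U_X`, `B` is covered by two
  opens with regular open-immersion neighbourhoods and the range of an open immersion
  `iV : V → B`, and `V` is already resolved away from a regular open `U_V` compatible with the
  cover, then `X` is resolved away from `U_X` (glue with `stub_hasResolution_glue`, compose);
* `xChart_openImmersion_of_range` — a ring `T` presented as the affine blow-up algebra `R[I/x]`,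
  `I = (x, y, z)`, gives an open immersion `Spec T → Bl_I(Spec R)` onto the chart `D₊(xt)` with the
  expected preimages of `D₊(yt)`, `D₊(zt)` and `D(x)`;
* `affineBlowup_cover_fin_three`, `tower_cover`, `tower_hle`, `span_range_fin_three` — the chart
  cover of `Bl_{(v 0, v 1, v 2)} Spec R` and the inclusion
  `π₀⁻¹ (D(v 0) ∪ D(v 1) ∪ D(v 2)) ⊆ D₊((v 0)t) ∪ D₊((v 1)t) ∪ iV(U_V)`;
* `specMap_preimage_basicOpen`, `isRegular_opens_of_stalk` — bookkeeping.

All folklore (Kollár 2007 §2.2; Hartshorne II.7; Stacks 0804, 02OS); no published fact is used.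
-/

-- single-problem summit: the doubled namespace component is forced
set_option linter.dupNamespace false

noncomputable section

namespace Summit.ResolutionOfSingularities.ResolutionOfSingularities.Theorems.FRationalResolution

open CategoryTheory AlgebraicGeometry TopologicalSpace
open Literature.AlgebraicGeometry.Resolution

/-- The preimage of a basic open of `Spec A` under `Spec` of a ring map `f : A → B` is the basic
open of the image. [folklore] -/
theorem specMap_preimage_basicOpen {A B : Type} [CommRing A] [CommRing B] (f : A →+* B) (a : A) :
    Spec.map (CommRingCat.ofHom f) ⁻¹ᵁ (PrimeSpectrum.basicOpen a : (Spec (CommRingCat.of A)).Opens) =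
      (PrimeSpectrum.basicOpen (f a) : (Spec (CommRingCat.of B)).Opens) := by
  ext p
  exact Iff.rfl

/-- An open subscheme all of whose points have regular stalks (in the ambient scheme) is a regular
scheme. [folklore] -/
theorem isRegular_opens_of_stalk {Y : Scheme.{0}} (W : Y.Opens)
    (h : ∀ y : Y, y ∈ W → IsRegularLocalRing (Y.presheaf.stalk y)) :
    Scheme.IsRegular (W : Scheme.{0}) := by
  intro w
  haveI := h (W.ι w) (by rw [Scheme.Opens.ι_apply]; exact w.2)
  exact IsRegularLocalRing.of_ringEquiv (asIso (W.ι.stalkMap w)).commRingCatIsoToRingEquiv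

/-- **The `x`-chart of a blow-up `Bl_{(x,y,z)} Spec R` presented by a ring `T ≅ R[I/x]`.** Let
`I = (x, y, z) ⊆ R` and let `f : T → R[1/x]` be an injective ring map with range the affine blow-up
algebra `R[I/x]`, and `a, b, c ∈ T` with `f c = x/1`, `f a · x = y/1`, `f b · x = z/1`. Then there
is an OPEN IMMERSION `iV : Spec T → Bl_I(Spec R)` with range the chart `D₊(xt)`, under which
`D₊(yt)`, `D₊(zt)` pull back to `D(a)`, `D(b)`, and `D(x) ⊆ Spec R` pulls back (through the
blow-down) to `D(c)`. (`reesChartEquiv : (R[It])_{(xt)} ≅ R[I/x]`; the transition elements `yt/xt`,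
`zt/xt` go to `a`, `b` because `y/1 = (yt/xt)·(x/1)`, `reesChartBase_eq_isLocalizationElem_mul`;
`iV = Spec(e) ≫ chartι`, `Proj.opensRange_awayι`, `Proj.awayι_preimage_basicOpen`.) Everything is
stated for ABSTRACT rings `R`, `T`, so that no instance unification ever unfolds a concrete
quotient ring. [folklore] -/
theorem xChart_openImmersion_of_range (R : Type) [CommRing R] (x y z : R) (I : Ideal R)
    (hI : I = Ideal.span {x, y, z}) (hy : y ∈ I) (hz : z ∈ I) (hx : x ∈ I)
    (T : Type) [CommRing T] {F : Type} [FunLike F T (Localization.Away x)]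
    [RingHomClass F T (Localization.Away x)] (f : F) (hfinj : Function.Injective f)
    (hfrange : Set.range f = (blowupAlgebra (Ideal.span {x, y, z}) x : Set (Localization.Away x)))
    (a b c : T) (hfc : f c = algebraMap R _ x) (hfa : f a * algebraMap R _ x = algebraMap R _ y)
    (hfb : f b * algebraMap R _ x = algebraMap R _ z) :
    ∃ iV : Spec (CommRingCat.of T) ⟶ affineBlowup I, IsOpenImmersion iV ∧
      Set.range iV = (Proj.basicOpen (reesGrading I) (reesT x hx) : Set (affineBlowup I)) ∧
      iV ⁻¹ᵁ Proj.basicOpen (reesGrading I) (reesT y hy) = PrimeSpectrum.basicOpen a ∧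
      iV ⁻¹ᵁ Proj.basicOpen (reesGrading I) (reesT z hz) = PrimeSpectrum.basicOpen b ∧
      (iV ≫ affineBlowup.π I) ⁻¹ᵁ (PrimeSpectrum.basicOpen x : (Spec (CommRingCat.of R)).Opens) =
        PrimeSpectrum.basicOpen c := by
  subst hI
  -- `ψ : T ≃ R[I/x]`
  have hmem : ∀ r : T, f r ∈ blowupAlgebra (Ideal.span {x, y, z}) x := fun r => by
    rw [← SetLike.mem_coe, ← hfrange]; exact ⟨r, rfl⟩
  set ψ₀ : T →+* blowupAlgebra (Ideal.span {x, y, z}) x :=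
    (f : T →+* Localization.Away x).codRestrict _ hmem with hψ₀
  have hψ₀bij : Function.Bijective ψ₀ := by
    refine ⟨fun a b hab => hfinj (congrArg Subtype.val hab), fun w => ?_⟩
    have hw : (w : Localization.Away x) ∈ Set.range f := by rw [hfrange]; exact w.2
    obtain ⟨r, hr⟩ := hw
    exact ⟨r, Subtype.ext hr⟩
  set ψ := RingEquiv.ofBijective ψ₀ hψ₀bij with hψ
  have hψval : ∀ r : T, ((ψ r : blowupAlgebra (Ideal.span {x, y, z}) x) :
      Localization.Away x) = f r := fun r => rfl
  -- the chart ring `(R[It])_{(xt)} ≅ R[I/x]` is `reesChartEquiv x hx`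
  have hunit : IsUnit (algebraMap R (Localization.Away x) x) :=
    IsLocalization.Away.algebraMap_isUnit x
  -- transition elements: `c/1 = (ct/xt) · (x/1)` in the chart ring, for `c = y, z`
  have htrans : ∀ (c' : R) (hc' : c' ∈ Ideal.span {x, y, z}) (t : T),
      f t * algebraMap R (Localization.Away x) x = algebraMap R (Localization.Away x) c' →
      ((reesChartEquiv (I := Ideal.span {x, y, z}) x hx).trans ψ.symm)
        (HomogeneousLocalization.Away.isLocalizationElem (reesT_mem x hx) (reesT_mem c' hc')) =
          t := by
    intro c' hc' t hφ
    apply ψ.injective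
    rw [RingEquiv.trans_apply, RingEquiv.apply_symm_apply]
    apply Subtype.ext
    rw [hψval]
    refine (hunit.mul_left_inj).mp ?_
    rw [hφ]
    have h := congrArg (fun w => ((reesChartEquiv (I := Ideal.span {x, y, z}) x hx w :
      blowupAlgebra (Ideal.span {x, y, z}) x) : Localization.Away x))
      (reesChartBase_eq_isLocalizationElem_mul x hx c' hc')
    simp only [map_mul, reesChartEquiv_reesChartBase, Subalgebra.coe_mul,
      Subalgebra.coe_algebraMap] at h
    exact h.symm
  set e : HomogeneousLocalization.Away (reesGrading (Ideal.span {x, y, z})) (reesT x hx) ≃+* T :=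
    (reesChartEquiv (I := Ideal.span {x, y, z}) x hx).trans ψ.symm with he
  have hey := htrans y hy a hfa
  have hez := htrans z hz b hfb
  have hex : e (reesChartBase (I := Ideal.span {x, y, z}) x hx x) = c := by
    apply ψ.injective
    rw [he, RingEquiv.trans_apply, RingEquiv.apply_symm_apply, reesChartEquiv_reesChartBase]
    apply Subtype.ext
    rw [hψval, hfc, Subalgebra.coe_algebraMap]
  -- scheme level: `iV = Spec(e) ≫ chartι`
  have hpre : ∀ (c' : R) (hc' : c' ∈ Ideal.span {x, y, z}) (t : T),
      e (HomogeneousLocalization.Away.isLocalizationElem (reesT_mem x hx) (reesT_mem c' hc')) = t →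
      (Spec.map e.toCommRingCatIso.hom ≫ affineBlowup.chartι (I := Ideal.span {x, y, z}) x hx) ⁻¹ᵁ
          Proj.basicOpen (reesGrading (Ideal.span {x, y, z})) (reesT c' hc') =
        PrimeSpectrum.basicOpen t := by
    intro c' hc' t hec
    rw [Scheme.Hom.comp_preimage, affineBlowup.chartι,
      Proj.awayι_preimage_basicOpen _ (reesT_mem x hx) one_pos (reesT_mem c' hc') one_pos,
      RingEquiv.toCommRingCatIso_hom, specMap_preimage_basicOpen]
    exact congrArg _ (by simpa using hec)
  have hVπ : (Spec.map e.toCommRingCatIso.hom ≫ affineBlowup.chartι (I := Ideal.span {x, y, z}) x hx) ≫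
      affineBlowup.π (Ideal.span {x, y, z}) =
      Spec.map (CommRingCat.ofHom ((e : _ →+* T).comp (reesChartBase x hx))) := by
    rw [Category.assoc, affineBlowup.chartι_π, ← Spec.map_comp, RingEquiv.toCommRingCatIso_hom]
    rfl
  refine ⟨Spec.map e.toCommRingCatIso.hom ≫ affineBlowup.chartι (I := Ideal.span {x, y, z}) x hx,
    ?_, ?_, ?_, ?_, ?_⟩
  · infer_instance
  · rw [← Scheme.Hom.coe_opensRange, Scheme.Hom.opensRange_comp_of_isIso, chartι_opensRange_eq]
  · exact hpre y hy _ hey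
  · exact hpre z hz _ hez
  · rw [hVπ, specMap_preimage_basicOpen]
    exact congrArg _ (by simpa using hex)

/-- **ONE STEP OF A TOWER OF BLOW-UPS (abstract gluing pattern).** Let `π₀ : B → X` be proper and
an isomorphism over the open `U_X ⊆ X`, with `π₀⁻¹ S` dense for some open `S ⊆ U_X`. Suppose `B`
is covered by two opens `C₁, C₂`, every point of which has a regular open-immersion neighbourhood,
and the range of an open immersion `iV : V → B`; let `U_V ⊆ V` be a regular open containing
`iV⁻¹ C₁`, `iV⁻¹ C₂`, with `π₀⁻¹ U_X ⊆ C₁ ∪ C₂ ∪ iV(U_V)`. If `V` admits a proper `ρ : Y → V`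
from a regular scheme which is an isomorphism over `U_V` with dense preimage, then `X` admits a
proper morphism from a regular scheme which is an isomorphism over `U_X` with dense preimage:
glue `ρ` into the regular open `C₁ ∪ C₂ ∪ iV(U_V)` (`stub_hasResolution_glue`) and compose with
`π₀`. Stated for abstract schemes (cheap to elaborate; reusable for every tower). [folklore;
Kollár 2007 §2.2] -/
theorem towerStep {X B V Y : Scheme.{0}} (π₀ : B ⟶ X) [IsProper π₀] (UX : X.Opens)
    (hπ₀iso : IsIso (π₀ ∣_ UX)) (S : X.Opens) (hSU : S ≤ UX)
    (hSd : Dense ((π₀ ⁻¹ᵁ S : B.Opens) : Set B)) (C₁ C₂ : B.Opens)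
    (hC₁ : ∀ p ∈ C₁, ∃ (U : Scheme.{0}) (j : U ⟶ B), IsOpenImmersion j ∧ p ∈ Set.range j ∧
      Scheme.IsRegular U)
    (hC₂ : ∀ p ∈ C₂, ∃ (U : Scheme.{0}) (j : U ⟶ B), IsOpenImmersion j ∧ p ∈ Set.range j ∧
      Scheme.IsRegular U)
    (iV : V ⟶ B) [IsOpenImmersion iV] (UV : V.Opens) (hUV : Scheme.IsRegular (UV : Scheme.{0}))
    (hV₁ : iV ⁻¹ᵁ C₁ ≤ UV) (hV₂ : iV ⁻¹ᵁ C₂ ≤ UV)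
    (hcov : ∀ p : B, p ∈ C₁ ∨ p ∈ C₂ ∨ p ∈ Set.range iV)
    (hle : π₀ ⁻¹ᵁ UX ≤ C₁ ⊔ C₂ ⊔ iV ''ᵁ UV)
    (ρ : Y ⟶ V) [IsProper ρ] (hY : Scheme.IsRegular Y) (hρiso : IsIso (ρ ∣_ UV))
    (hρd : Dense ((ρ ⁻¹ᵁ UV : Y.Opens) : Set Y)) :
    ∃ (X' : Scheme.{0}) (π : X' ⟶ X), IsProper π ∧ Scheme.IsRegular X' ∧ IsIso (π ∣_ UX) ∧
      Dense ((π ⁻¹ᵁ UX : X'.Opens) : Set X') := by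
  let Uo : B.Opens := C₁ ⊔ C₂ ⊔ iV ''ᵁ UV
  have hUo_pre : iV ⁻¹ᵁ Uo = UV := by
    apply le_antisymm
    · intro q hq
      rcases hq with (h | h) | h
      · exact hV₁ h
      · exact hV₂ h
      · have h' : q ∈ iV ⁻¹ᵁ (iV ''ᵁ UV) := h
        rwa [Scheme.Hom.preimage_image_eq] at h'
    · intro q hq
      have h' : q ∈ iV ⁻¹ᵁ (iV ''ᵁ UV) := by rwa [Scheme.Hom.preimage_image_eq]
      exact Or.inr h'
  have hcover : Uo.ι.opensRange ⊔ iV.opensRange = ⊤ := by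
    rw [Scheme.Opens.opensRange_ι]
    refine top_le_iff.mp fun p _ => ?_
    rcases hcov p with h | h | h
    · exact Or.inl (Or.inl (Or.inl h))
    · exact Or.inl (Or.inl (Or.inr h))
    · exact Or.inr h
  have hUreg : Scheme.IsRegular (Uo : Scheme.{0}) := by
    refine isRegular_opens_of_forall_exists Uo fun p hp => ?_
    rcases hp with (h | h) | h
    · exact hC₁ p h
    · exact hC₂ p h
    · obtain ⟨q, hq, rfl⟩ := h
      refine ⟨_, UV.ι ≫ iV, inferInstance, ⟨⟨q, hq⟩, ?_⟩, hUV⟩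
      rw [Scheme.Hom.comp_apply, Scheme.Opens.ι_apply]
      rfl
  have hiso' : IsIso (ρ ∣_ (iV ⁻¹ᵁ Uo.ι.opensRange)) := by
    rw [Scheme.Opens.opensRange_ι, hUo_pre]; exact hρiso
  have hd' : Dense ((ρ ⁻¹ᵁ (iV ⁻¹ᵁ Uo.ι.opensRange) : Y.Opens) : Set Y) := by
    rw [Scheme.Opens.opensRange_ι, hUo_pre]; exact hρd
  -- glue `ρ` into the regular open `Uo`
  obtain ⟨X', π', hπ', hX'reg, hisoU, hdU⟩ :=
    stub_hasResolution_glue B _ _ Y Uo.ι iV hcover hUreg ρ hY hiso' hd'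
  rw [Scheme.Opens.opensRange_ι] at hisoU hdU
  haveI := hπ'
  refine ⟨X', π' ≫ π₀, inferInstance, hX'reg, ?_, ?_⟩
  · haveI h1 : IsIso (π' ∣_ π₀ ⁻¹ᵁ UX) := isIso_morphismRestrict_of_le π' hisoU hle
    haveI h2 : IsIso (π₀ ∣_ UX) := hπ₀iso
    have h12 : IsIso ((π' ∣_ π₀ ⁻¹ᵁ UX) ≫ (π₀ ∣_ UX)) := IsIso.comp_isIso
    rw [morphismRestrict_comp]
    exact h12
  · have hdense := dense_preimage_inter_of_isIso_morphismRestrict π' hisoU hdU hSd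
    refine hdense.mono ?_
    rintro x ⟨-, hx⟩
    have hx' : π₀ (π' x) ∈ S := hx
    show (π' ≫ π₀) x ∈ UX
    rw [Scheme.Hom.comp_apply]
    exact hSU hx'

/-- The ideal of a family of three elements is generated by them, listed in any order. [folklore] -/
theorem span_range_fin_three {R : Type} [CommRing R] (v : Fin 3 → R) :
    Ideal.span (Set.range v) = Ideal.span {v 2, v 0, v 1} := by
  congr 1
  ext q
  simp only [Set.mem_range, Set.mem_insert_iff, Set.mem_singleton_iff]
  constructor
  · rintro ⟨i, rfl⟩
    fin_cases i <;> simp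
  · rintro (rfl | rfl | rfl) <;> exact ⟨_, rfl⟩

/-- **The three charts `D₊((v i) t)` cover `Bl_{(v 0, v 1, v 2)} Spec R`**, pointwise form of
`affineBlowup.iSup_basicOpen_reesT_generators_eq_top` (abstract `R`, so that the case analysis on
the chart index is cheap). [cite: StacksProject, Tag 0804] -/
theorem affineBlowup_cover_fin_three {R : Type} [CommRing R] (v : Fin 3 → R)
    (p : affineBlowup (Ideal.span (Set.range v))) :
    p ∈ Proj.basicOpen (reesGrading (Ideal.span (Set.range v)))
        (reesT (v 0) (Ideal.mem_span_range_self (f := v) (x := 0))) ∨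
      p ∈ Proj.basicOpen (reesGrading (Ideal.span (Set.range v)))
        (reesT (v 1) (Ideal.mem_span_range_self (f := v) (x := 1))) ∨
      p ∈ Proj.basicOpen (reesGrading (Ideal.span (Set.range v)))
        (reesT (v 2) (Ideal.mem_span_range_self (f := v) (x := 2))) := by
  have hp : p ∈ (⨆ i : Fin 3, Proj.basicOpen (reesGrading (Ideal.span (Set.range v)))
      (reesT (v i) (Ideal.mem_span_range_self (f := v) (x := i)))) := by
    rw [affineBlowup.iSup_basicOpen_reesT_generators_eq_top v]; trivial
  obtain ⟨i, hi⟩ := Opens.mem_iSup.mp hp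
  fin_cases i
  · exact Or.inl hi
  · exact Or.inr (Or.inl hi)
  · exact Or.inr (Or.inr hi)

/-- Pointwise chart cover of `Bl_{(v)} Spec R` with the third chart replaced by the range of a
morphism `iV` onto it (abstract `R`). [folklore] -/
theorem tower_cover {R : Type} [CommRing R] (v : Fin 3 → R) {V : Scheme.{0}}
    (iV : V ⟶ affineBlowup (Ideal.span (Set.range v)))
    (hrange : ∀ p : affineBlowup (Ideal.span (Set.range v)), p ∈ Set.range iV ↔
      p ∈ Proj.basicOpen (reesGrading (Ideal.span (Set.range v)))
        (reesT (v 2) (Ideal.mem_span_range_self (f := v) (x := 2))))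
    (p : affineBlowup (Ideal.span (Set.range v))) :
    p ∈ Proj.basicOpen (reesGrading (Ideal.span (Set.range v)))
        (reesT (v 0) (Ideal.mem_span_range_self (f := v) (x := 0))) ∨
      p ∈ Proj.basicOpen (reesGrading (Ideal.span (Set.range v)))
        (reesT (v 1) (Ideal.mem_span_range_self (f := v) (x := 1))) ∨
      p ∈ Set.range iV := by
  rcases affineBlowup_cover_fin_three v p with h | h | h
  · exact Or.inl h
  · exact Or.inr (Or.inl h)
  · exact Or.inr (Or.inr ((hrange p).mpr h))

/-- **`π₀⁻¹ (D(v 0) ∪ D(v 1) ∪ D(v 2)) ⊆ D₊((v 0)t) ∪ D₊((v 1)t) ∪ iV(U_V)`** for the blow-down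
`π₀ : Bl_{(v)} Spec R → Spec R`, when `iV` has range `D₊((v 2)t)` and `(iV ≫ π₀)⁻¹ D(v 2) ⊆ U_V`
(abstract `R`; Stacks 02OS `π₀⁻¹ D(b) ⊆ D₊(bt)`, `affineBlowup.preimage_basicOpen_le`). [folklore] -/
theorem tower_hle {R : Type} [CommRing R] (v : Fin 3 → R) {V : Scheme.{0}}
    (iV : V ⟶ affineBlowup (Ideal.span (Set.range v))) [IsOpenImmersion iV] (UV : V.Opens)
    (hrange : ∀ p : affineBlowup (Ideal.span (Set.range v)), p ∈ Set.range iV ↔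
      p ∈ Proj.basicOpen (reesGrading (Ideal.span (Set.range v)))
        (reesT (v 2) (Ideal.mem_span_range_self (f := v) (x := 2))))
    (hVπx : (iV ≫ affineBlowup.π (Ideal.span (Set.range v))) ⁻¹ᵁ
      (PrimeSpectrum.basicOpen (v 2) : (Spec (CommRingCat.of R)).Opens) ≤ UV) :
    affineBlowup.π (Ideal.span (Set.range v)) ⁻¹ᵁ
        ((PrimeSpectrum.basicOpen (v 0) ⊔ PrimeSpectrum.basicOpen (v 1) ⊔
          PrimeSpectrum.basicOpen (v 2)) : (Spec (CommRingCat.of R)).Opens) ≤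
      Proj.basicOpen (reesGrading (Ideal.span (Set.range v)))
          (reesT (v 0) (Ideal.mem_span_range_self (f := v) (x := 0))) ⊔
        Proj.basicOpen (reesGrading (Ideal.span (Set.range v)))
          (reesT (v 1) (Ideal.mem_span_range_self (f := v) (x := 1))) ⊔ iV ''ᵁ UV := by
  intro p hp
  rcases hp with (h | h) | h
  · exact Or.inl (Or.inl (affineBlowup.preimage_basicOpen_le (I := Ideal.span (Set.range v))
      (v 0) (Ideal.mem_span_range_self (x := 0)) h))
  · exact Or.inl (Or.inr (affineBlowup.preimage_basicOpen_le (I := Ideal.span (Set.range v))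
      (v 1) (Ideal.mem_span_range_self (x := 1)) h))
  · -- `p ∈ π₀⁻¹ D(v 2) ⊆ D₊((v 2)t) = range iV`, and its preimage in `V` lies in `U_V`
    have hpx : p ∈ Set.range iV := (hrange p).mpr
      (affineBlowup.preimage_basicOpen_le (I := Ideal.span (Set.range v)) (v 2)
        (Ideal.mem_span_range_self (x := 2)) h)
    obtain ⟨q, rfl⟩ := hpx
    have hq : q ∈ (iV ≫ affineBlowup.π (Ideal.span (Set.range v))) ⁻¹ᵁ
        (PrimeSpectrum.basicOpen (v 2) : (Spec (CommRingCat.of R)).Opens) := by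
      show (iV ≫ affineBlowup.π (Ideal.span (Set.range v))) q ∈ PrimeSpectrum.basicOpen (v 2)
      rw [Scheme.Hom.comp_apply]
      exact h
    exact Or.inr ⟨q, hVπx hq, rfl⟩

end Summit.ResolutionOfSingularities.ResolutionOfSingularities.Theorems.FRationalResolution

end
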